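import Literature.Analysis.FluidPDE.TaoEnstrophyIdentity
import Literature.Analysis.FluidPDE.SphereIntegral
import Mathlib.Analysis.SpecialFunctions.Sqrt
import HarnessLib

/-!
# Tao (2011/2013), proof of Thm. 10.1: the heat-flux term `Y₃` for the annular Lipschitz cutoff

Tao's bound `Y₃ ≲ b(t)` (arXiv:1108.1165, p. 31: "Computing the distributional
Laplacian of `η` in polar coordinates, we see that `Y₃ ≲ b(t)` where
`b(t) := c^{-0.1}δ²R²∫_{S²}|ω(t,R'(t)α)|²dα + c^{-0.2}δ⁴∫_{R'(t)−c^{0.1}δ^{-2} ≤ |x| ≤ R'(t)}|ω|²`")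
for the annular cutoff `η = annularRamp k a b ‖· − x₀‖` of `TaoMovingCutoff.lean`, proved in the
integrated-by-parts form in which `Y₃` appears in `TaoEnstrophyIdentity.lean`:

* `NS.hasFDerivAt_annularRamp_norm` — away from the four kink spheres (a null set) the cutoff
  is differentiable, with gradient `+k x̂` on the inner transition layer, `−k x̂` on the outer
  one (`x̂ = (x − x₀)/‖x − x₀‖`) and `0` on the plateau and outside;
* `NS.sum_inner_fderiv_mul_lineDeriv_eq` — consequently, a.e.,
  `Σⱼ ⟨ω, ∂ⱼω⟩ ∂ⱼη = c(x) · ∂ᵣ(½|ω|²)` with `c ∈ {k, −k, 0}` the layer coefficient, so that the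
  `Y₃`-term of `NS.integral_enstrophyProduction_mul_weight` is `k` times the integral of the
  radial derivative of `½|ω|²` over the inner layer minus that over the outer layer — to which
  the radial divergence theorem on shells (`SphereIntegral.setIntegral_shell_radialDeriv_eq`)
  applies (`NS.sum_integral_inner_fderiv_mul_lineDeriv_annularRamp`);
* `NS.radialDerivNormSq`, `NS.sphereNormSq ζ x₀ r = ∫_{S²}|ζ(x₀ + rα)|²dσ(α)` (Mathlib's
  `Measure.toSphere` surface measure, through `SphereIntegral.sphereIntegral`) and the layer
  formula `NS.setIntegral_layer_radialDerivNormSq`: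
  `∫_{α<‖x−x₀‖<β} ∂ᵣ|ζ|² = β²S(β) − α²S(α) − 2∫_{α<‖x−x₀‖<β}|ζ|²/‖x−x₀‖` (`0 < α ≤ β`);
* `NS.heatFlux_le` — the bound itself, in the explicit annular form
  `Y₃ = −νΣⱼ∫⟨ζ,∂ⱼζ⟩∂ⱼη ≤ (νk/2)(a²S(a) + b²S(b)) + νk∫_{a<‖x−x₀‖<a+k⁻¹}|ζ|²/‖x−x₀‖`: the two
  discarded spheres `a + k⁻¹`, `b − k⁻¹` carry negative signs (Tao's "this component is negative
  and thus can be discarded"), the last term is the curvature contribution of the inner ramp,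
  absent in the ball case.

## References

* T. Tao, arXiv:1108.1165 (`Tao2011`), §10, proof of Thm. 10.1 (p. 31, the term `Y₃`).
-/

noncomputable section

open MeasureTheory Set Function Filter Topology Metric InnerProductSpace
open scoped RealInnerProductSpace NNReal

namespace Literature.Analysis.FluidPDE

/-- Local notation for physical space `ℝ³ = EuclideanSpace ℝ (Fin 3)`. -/
local notation "ℝ³" => EuclideanSpace ℝ (Fin 3)

/-- Local notation for the standard basis vectors. -/
local notation "𝐞" j => EuclideanSpace.single (j : Fin 3) (1 : ℝ)

/-! ## The gradient of the norm and of the annular cutoff -/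

/-- **Gradient of the annular cutoff.** Let `η = annularRamp k a b ‖· − x₀‖` with `0 < a` and
a nonempty plateau (`a + k⁻¹ < b − k⁻¹`). Away from the four kink spheres
`‖x − x₀‖ ∈ {a, a + k⁻¹, b − k⁻¹, b}` (Lebesgue-null), `η` is differentiable at `x` with
`Dη(x) = c • D‖· − x₀‖(x)`, `c = k` on the inner layer, `c = −k` on the outer layer, `c = 0` on the
plateau and off the annulus (so `|∇η| = k = c^{-0.1}δ²` exactly on the two transition layers; Tao,
p. 32: "observe that `c^{-0.1} δ² = |∇η|` on `Bᵢ`" for balls in the region where `η` is not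
constant). The derivative of the norm away from the origin, `D‖·‖(z) = ‖z‖⁻¹⟨z, ·⟩`, is derived
inline from Mathlib's `hasStrictFDerivAt_norm_sq` (the tree has this formula as
`Literature.Topology.FourManifolds.hasFDerivAt_norm_of_ne_zero` in an unrelated topic file, not imported here). [cite: Tao2011, §10, proof of Thm. 10.1 (the cutoff η), p. 30] -/
theorem hasFDerivAt_annularRamp_norm {k a b : ℝ} (hk : 0 < k) (ha : 0 < a)
    (hgap : a + k⁻¹ < b - k⁻¹) {x₀ x : ℝ³}
    (h1 : ‖x - x₀‖ ≠ a) (h2 : ‖x - x₀‖ ≠ a + k⁻¹) (h3 : ‖x - x₀‖ ≠ b - k⁻¹) (h4 : ‖x - x₀‖ ≠ b) :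
    HasFDerivAt (fun y : ℝ³ => annularRamp k a b ‖y - x₀‖)
      ((if a < ‖x - x₀‖ ∧ ‖x - x₀‖ < a + k⁻¹ then k
        else if b - k⁻¹ < ‖x - x₀‖ ∧ ‖x - x₀‖ < b then -k else 0) •
        (‖x - x₀‖⁻¹ • innerSL ℝ (x - x₀))) x := by
  have hkinv : 0 < k⁻¹ := inv_pos.2 hk
  have hρc : Continuous fun y : ℝ³ => ‖y - x₀‖ := by fun_prop
  -- the norm `‖· − x₀‖` is differentiable at `x` as soon as `‖x − x₀‖ > a > 0`
  have hnorm : a < ‖x - x₀‖ →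
      HasFDerivAt (fun y : ℝ³ => ‖y - x₀‖) (‖x - x₀‖⁻¹ • innerSL ℝ (x - x₀)) x := by
    intro hax
    have hx0 : x - x₀ ≠ 0 := fun h => by rw [h, norm_zero] at hax; linarith
    -- `D‖·‖(z) = ‖z‖⁻¹ ⟨z, ·⟩` at `z = x − x₀ ≠ 0`, from `D(‖·‖²)` and the square root
    have hnz : HasFDerivAt (fun z : ℝ³ => ‖z‖) (‖x - x₀‖⁻¹ • innerSL ℝ (x - x₀)) (x - x₀) := by
      have h0 : ‖x - x₀‖ ^ 2 ≠ 0 := pow_ne_zero 2 (norm_ne_zero_iff.2 hx0)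
      have h := ((hasStrictFDerivAt_norm_sq (x - x₀)).hasFDerivAt).sqrt h0
      have hfun : (fun z : ℝ³ => Real.sqrt (‖z‖ ^ 2)) = fun z => ‖z‖ := funext fun z =>
        Real.sqrt_sq (norm_nonneg z)
      rw [hfun, Real.sqrt_sq (norm_nonneg (x - x₀))] at h
      refine h.congr_fderiv ?_
      ext v
      have hx' : ‖x - x₀‖ ≠ 0 := norm_ne_zero_iff.2 hx0
      simp [innerSL_apply_apply]
      field_simp
    have h : HasFDerivAt (fun y : ℝ³ => ‖y - x₀‖)
        ((‖x - x₀‖⁻¹ • innerSL ℝ (x - x₀)).comp (ContinuousLinearMap.id ℝ ℝ³)) x :=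
      hnz.comp x ((hasFDerivAt_id x).sub_const x₀)
    rwa [ContinuousLinearMap.comp_id] at h
  rcases lt_or_gt_of_ne h1 with r1 | r1
  · -- inside the inner radius: locally `0`
    have hev : ∀ᶠ y in 𝓝 x, annularRamp k a b ‖y - x₀‖ = 0 := by
      filter_upwards [hρc.continuousAt.eventually_lt continuous_const.continuousAt r1] with y hy
      exact annularRamp_eq_zero_of_le_inner hk.le hy.le
    rw [if_neg (fun h => absurd (r1.trans h.1) (lt_irrefl _)),
      if_neg (fun h => by linarith [h.1]), zero_smul]
    exact (hasFDerivAt_const (0 : ℝ) x).congr_of_eventuallyEq hev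
  rcases lt_or_gt_of_ne h2 with r2 | r2
  · -- inner layer: locally `k(ρ − a)`
    have hev : ∀ᶠ y in 𝓝 x, annularRamp k a b ‖y - x₀‖ = k * (‖y - x₀‖ - a) := by
      filter_upwards [continuous_const.continuousAt.eventually_lt hρc.continuousAt r1,
        hρc.continuousAt.eventually_lt continuous_const.continuousAt r2,
        hρc.continuousAt.eventually_lt continuous_const.continuousAt (r2.trans hgap)]
        with y hy1 hy2 hy3
      exact annularRamp_eq_inner hk hy1.le hy2.le hy3.le
    rw [if_pos ⟨r1, r2⟩]
    have h := ((hnorm r1).sub_const a).const_mul k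
    exact h.congr_of_eventuallyEq hev
  rcases lt_or_gt_of_ne h3 with r3 | r3
  · -- plateau: locally `1`
    have hev : ∀ᶠ y in 𝓝 x, annularRamp k a b ‖y - x₀‖ = 1 := by
      filter_upwards [continuous_const.continuousAt.eventually_lt hρc.continuousAt r2,
        hρc.continuousAt.eventually_lt continuous_const.continuousAt r3] with y hy1 hy2
      exact annularRamp_eq_one hk hy1.le hy2.le
    rw [if_neg (fun h => absurd (h.2.trans r2) (lt_irrefl _)),
      if_neg (fun h => absurd (h.1.trans r3) (lt_irrefl _)), zero_smul]
    exact (hasFDerivAt_const (1 : ℝ) x).congr_of_eventuallyEq hev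
  rcases lt_or_gt_of_ne h4 with r4 | r4
  · -- outer layer: locally `k(b − ρ)`
    have hev : ∀ᶠ y in 𝓝 x, annularRamp k a b ‖y - x₀‖ = k * (b - ‖y - x₀‖) := by
      filter_upwards [continuous_const.continuousAt.eventually_lt hρc.continuousAt (hgap.trans r3),
        continuous_const.continuousAt.eventually_lt hρc.continuousAt r3,
        hρc.continuousAt.eventually_lt continuous_const.continuousAt r4] with y hy1 hy2 hy3
      exact annularRamp_eq_outer hk hy1.le hy2.le hy3.le
    have hr2' : a + k⁻¹ < ‖x - x₀‖ := r2
    rw [if_neg (fun h => absurd (h.2.trans hr2') (lt_irrefl _)), if_pos ⟨r3, r4⟩]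
    have hr1 : a < ‖x - x₀‖ := by linarith
    have h := ((hnorm hr1).const_sub b).const_mul k
    refine (h.congr_of_eventuallyEq hev).congr_fderiv ?_
    rw [smul_neg, neg_smul]
  · -- outside the outer radius: locally `0`
    have hev : ∀ᶠ y in 𝓝 x, annularRamp k a b ‖y - x₀‖ = 0 := by
      filter_upwards [continuous_const.continuousAt.eventually_lt hρc.continuousAt r4] with y hy
      exact annularRamp_eq_zero_of_outer_le hk.le hy.le
    have hr2' : a + k⁻¹ < ‖x - x₀‖ := r2
    rw [if_neg (fun h => absurd (h.2.trans hr2') (lt_irrefl _)),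
      if_neg (fun h => absurd (h.2.trans r4) (lt_irrefl _)), zero_smul]
    exact (hasFDerivAt_const (0 : ℝ) x).congr_of_eventuallyEq hev

/-! ## The `Y₃`-integrand for the annular cutoff -/

/-- **The heat-flux integrand.** At a point where the weight `η` is differentiable with gradient
`c · x̂`, `x̂ = (x − x₀)/‖x − x₀‖` (as for the annular cutoff away from its kink spheres,
`hasFDerivAt_annularRamp_norm`), the `Y₃`-integrand of the enstrophy identity is `c` times the
radial derivative of `½|ζ|²`: `Σⱼ ⟨ζ, ∂ⱼζ⟩ ∂ⱼη = c · ∂_{x̂}(½|ζ|²)`. [cite: Tao2011, §10, proof of Thm. 10.1 (the term Y₃)] -/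
theorem sum_inner_fderiv_mul_lineDeriv_eq {ζ : ℝ³ → ℝ³} {η : ℝ³ → ℝ} {x₀ x : ℝ³} {c : ℝ}
    (hζ : DifferentiableAt ℝ ζ x)
    (hη : HasFDerivAt η (c • (‖x - x₀‖⁻¹ • innerSL ℝ (x - x₀))) x) :
    ∑ j, ⟪ζ x, fderiv ℝ ζ x (𝐞 j)⟫ * lineDeriv ℝ η x (𝐞 j) =
      c * (1 / 2 * fderiv ℝ (fun y => ‖ζ y‖ ^ 2) x (‖x - x₀‖⁻¹ • (x - x₀))) := by
  have hηd : DifferentiableAt ℝ η x := hη.differentiableAt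
  -- coordinate expansion `L w = Σⱼ wⱼ • L eⱼ` (the tree's `Fluid.clm_apply_coord`, componentwise)
  have hL : ∀ (L : ℝ³ →L[ℝ] ℝ³) (w : ℝ³), L w = ∑ j, w j • L (𝐞 j) := fun L w => by
    ext i
    simp [Finset.sum_apply, FluidPDE.clm_apply_coord L w i]
  have hline : ∀ j : Fin 3, lineDeriv ℝ η x (𝐞 j) = c * (‖x - x₀‖⁻¹ * (x - x₀) j) := by
    intro j
    rw [hηd.lineDeriv_eq_fderiv, hη.fderiv]
    simp [innerSL_apply_apply, EuclideanSpace.inner_single_right]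
  simp_rw [hline]
  rw [← inner_fderiv_apply_eq_half_fderiv_norm_sq hζ, map_smul, inner_smul_right,
    hL (fderiv ℝ ζ x) (x - x₀), inner_sum, Finset.mul_sum, Finset.mul_sum]
  refine Finset.sum_congr rfl fun j _ => ?_
  rw [inner_smul_right]
  ring

/-! ## Splitting the `Y₃`-term over the two transition layers -/

section Layers

variable {ζ : ℝ³ → ℝ³} {x₀ : ℝ³} {k a b : ℝ}

/-- The radial derivative of `|ζ|²` about the centre `x₀`: `∂ᵣ|ζ|²(x) = D(|ζ|²)(x)((x−x₀)/‖x−x₀‖)`.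
Junk value `0` at the centre `x = x₀` (the direction is `‖0‖⁻¹ • 0 = 0`), a null set; every use
below integrates over shells `α < ‖x − x₀‖ < β` with `α > 0`. [folklore] -/
def radialDerivNormSq (ζ : ℝ³ → ℝ³) (x₀ : ℝ³) (x : ℝ³) : ℝ :=
  fderiv ℝ (fun y => ‖ζ y‖ ^ 2) x (‖x - x₀‖⁻¹ • (x - x₀))

/-- Unfolding `radialDerivNormSq`. [folklore] -/
theorem radialDerivNormSq_apply (ζ : ℝ³ → ℝ³) (x₀ x : ℝ³) :
    radialDerivNormSq ζ x₀ x = fderiv ℝ (fun y => ‖ζ y‖ ^ 2) x (‖x - x₀‖⁻¹ • (x - x₀)) := rfl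

/-- The radial derivative of `|ζ|²` is continuous away from the centre for `ζ ∈ C¹`. [folklore] -/
theorem continuousOn_radialDerivNormSq (hζ : ContDiff ℝ 1 ζ) (x₀ : ℝ³) :
    ContinuousOn (radialDerivNormSq ζ x₀) {x₀}ᶜ := by
  have hN : ContDiff ℝ 1 fun y => ‖ζ y‖ ^ 2 := hζ.norm_sq ℝ
  refine ((hN.continuous_fderiv one_ne_zero).continuousOn).clm_apply ?_
  refine (continuousOn_inv₀.comp (continuous_norm.comp (continuous_id.sub continuous_const)).continuousOn
    fun x hx => ?_).smul (continuousOn_id.sub continuousOn_const)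
  simpa [sub_eq_zero] using hx

/-- The radial derivative is bounded-measurable, hence integrable, on each bounded layer away
from the centre. [folklore] -/
theorem integrableOn_radialDerivNormSq_shell (hζ : ContDiff ℝ 1 ζ) (x₀ : ℝ³) {α β : ℝ}
    (hα : 0 < α) :
    IntegrableOn (radialDerivNormSq ζ x₀) {x : ℝ³ | α < ‖x - x₀‖ ∧ ‖x - x₀‖ < β} := by
  have hK : IsCompact {x : ℝ³ | α ≤ ‖x - x₀‖ ∧ ‖x - x₀‖ ≤ β} := by
    have : {x : ℝ³ | α ≤ ‖x - x₀‖ ∧ ‖x - x₀‖ ≤ β} ⊆ closedBall x₀ β := fun x hx => by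
      rw [mem_closedBall, dist_eq_norm]; exact hx.2
    exact (isCompact_closedBall x₀ β).of_isClosed_subset
      ((isClosed_le continuous_const (continuous_norm.comp (continuous_id.sub continuous_const))).inter
        (isClosed_le (continuous_norm.comp (continuous_id.sub continuous_const)) continuous_const)) this
  have hK0 : {x : ℝ³ | α ≤ ‖x - x₀‖ ∧ ‖x - x₀‖ ≤ β} ⊆ {x₀}ᶜ := fun x hx h0 => by
    rw [mem_singleton_iff] at h0
    have h1 : α ≤ ‖x - x₀‖ := hx.1
    rw [h0, sub_self, norm_zero] at h1
    linarith
  exact (((continuousOn_radialDerivNormSq hζ x₀).mono hK0).integrableOn_compact hK).mono_set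
    fun x hx => ⟨hx.1.le, hx.2.le⟩

/-- **The `Y₃`-term for the annular cutoff, split over the layers.** For `ζ ∈ C¹` and the cutoff
`η = annularRamp k a b ‖· − x₀‖` (`0 < a`, nonempty plateau),
`Σⱼ ∫ ⟨ζ, ∂ⱼζ⟩ ∂ⱼη = (k/2) ∫_{inner layer} ∂ᵣ|ζ|² − (k/2) ∫_{outer layer} ∂ᵣ|ζ|²`
(the gradient of `η` is `±k x̂` on the layers and `0` elsewhere, a.e.). [cite: Tao2011, §10, proof of Thm. 10.1 (the term Y₃)] -/
theorem sum_integral_inner_fderiv_mul_lineDeriv_annularRamp (hζ : ContDiff ℝ 1 ζ) (hk : 0 < k)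
    (ha : 0 < a) (hgap : a + k⁻¹ < b - k⁻¹) :
    ∑ j, ∫ x, ⟪ζ x, fderiv ℝ ζ x (𝐞 j)⟫ * lineDeriv ℝ (fun y : ℝ³ => annularRamp k a b ‖y - x₀‖) x (𝐞 j) =
      k / 2 * (∫ x in {x : ℝ³ | a < ‖x - x₀‖ ∧ ‖x - x₀‖ < a + k⁻¹}, radialDerivNormSq ζ x₀ x) -
        k / 2 * ∫ x in {x : ℝ³ | b - k⁻¹ < ‖x - x₀‖ ∧ ‖x - x₀‖ < b}, radialDerivNormSq ζ x₀ x := by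
  -- the cutoff as a Lipschitz compactly supported weight
  have hη : LipschitzWith (Real.toNNReal k) fun y : ℝ³ => annularRamp k a b ‖y - x₀‖ :=
    lipschitzWith_movingCutoff hk.le x₀ (fun _ => a) (fun _ => b) 0
  have hηc : HasCompactSupport fun y : ℝ³ => annularRamp k a b ‖y - x₀‖ :=
    hasCompactSupport_movingCutoff (ρ₁ := fun _ => a) (ρ₂ := fun _ => b) (t := 0) hk.le
  have hGc : ∀ j : Fin 3, Continuous fun x => ⟪ζ x, fderiv ℝ ζ x (𝐞 j)⟫ := fun j =>
    hζ.continuous.inner ((hζ.continuous_fderiv one_ne_zero).clm_apply continuous_const)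
  -- exchange sum and integral
  rw [← integral_finsetSum _ fun j _ => integrable_mul_lineDeriv (hGc j) hη hηc (𝐞 j)]
  -- the integrand a.e.: `c(x) · ½ ∂ᵣ|ζ|²`
  set I : Set ℝ³ := {x : ℝ³ | a < ‖x - x₀‖ ∧ ‖x - x₀‖ < a + k⁻¹} with hI
  set O : Set ℝ³ := {x : ℝ³ | b - k⁻¹ < ‖x - x₀‖ ∧ ‖x - x₀‖ < b} with hO
  have hρ : Continuous fun x : ℝ³ => ‖x - x₀‖ := by fun_prop
  have hIm : MeasurableSet I := by
    rw [hI]; exact (isOpen_lt continuous_const hρ).measurableSet.inter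
      (isOpen_lt hρ continuous_const).measurableSet
  have hOm : MeasurableSet O := by
    rw [hO]; exact (isOpen_lt continuous_const hρ).measurableSet.inter
      (isOpen_lt hρ continuous_const).measurableSet
  have hae : ∀ᵐ x : ℝ³, ∑ j, ⟪ζ x, fderiv ℝ ζ x (𝐞 j)⟫ *
      lineDeriv ℝ (fun y : ℝ³ => annularRamp k a b ‖y - x₀‖) x (𝐞 j) =
      k / 2 * I.indicator (radialDerivNormSq ζ x₀) x - k / 2 * O.indicator (radialDerivNormSq ζ x₀) x := by
    filter_upwards [ae_norm_sub_ne x₀ a, ae_norm_sub_ne x₀ (a + k⁻¹), ae_norm_sub_ne x₀ (b - k⁻¹),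
      ae_norm_sub_ne x₀ b] with x h1 h2 h3 h4
    rw [sum_inner_fderiv_mul_lineDeriv_eq ((hζ.differentiable one_ne_zero) x)
      (hasFDerivAt_annularRamp_norm hk ha hgap h1 h2 h3 h4), ← radialDerivNormSq_apply]
    by_cases hxI : a < ‖x - x₀‖ ∧ ‖x - x₀‖ < a + k⁻¹
    · have hxO : ¬(b - k⁻¹ < ‖x - x₀‖ ∧ ‖x - x₀‖ < b) := fun h => by linarith [h.1, hxI.2]
      rw [if_pos hxI, indicator_of_mem (show x ∈ I from hxI), indicator_of_notMem (show x ∉ O from hxO)]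
      ring
    · rw [if_neg hxI, indicator_of_notMem (show x ∉ I from hxI)]
      by_cases hxO : b - k⁻¹ < ‖x - x₀‖ ∧ ‖x - x₀‖ < b
      · rw [if_pos hxO, indicator_of_mem (show x ∈ O from hxO)]; ring
      · rw [if_neg hxO, indicator_of_notMem (show x ∉ O from hxO)]; ring
  rw [integral_congr_ae hae]
  have hiI : Integrable (I.indicator (radialDerivNormSq ζ x₀)) :=
    (integrableOn_radialDerivNormSq_shell hζ x₀ ha).integrable_indicator hIm
  have hiO : Integrable (O.indicator (radialDerivNormSq ζ x₀)) :=
    (integrableOn_radialDerivNormSq_shell hζ x₀ (by linarith [inv_pos.2 hk]) ).integrable_indicator hOm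
  rw [integral_sub (hiI.const_mul _) (hiO.const_mul _), integral_const_mul, integral_const_mul,
    integral_indicator hIm, integral_indicator hOm]

end Layers

/-! ## The layers in polar coordinates about `x₀` -/

section Polar

variable {ζ : ℝ³ → ℝ³} {x₀ : ℝ³}

/-- The sphere integrals of `|ζ|²` about the centre `x₀`: `S(r) = ∫ |ζ(x₀ + rα)|² dσ(α)`
(`r² S(r)` is the surface integral of `|ζ|²` over the sphere `‖x − x₀‖ = r`; the first term of
Tao's `b(t)`). [cite: Tao2011, §10, proof of Thm. 10.1 (the quantity b(t))] -/
def sphereNormSq (ζ : ℝ³ → ℝ³) (x₀ : ℝ³) (r : ℝ) : ℝ :=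
  sphereIntegral volume (fun y => ‖ζ (x₀ + y)‖ ^ 2) r

/-- Unfolding `sphereNormSq`. [folklore] -/
theorem sphereNormSq_def (ζ : ℝ³ → ℝ³) (x₀ : ℝ³) (r : ℝ) :
    sphereNormSq ζ x₀ r = sphereIntegral volume (fun y => ‖ζ (x₀ + y)‖ ^ 2) r := rfl

/-- `S(r) ≥ 0`. [folklore] -/
theorem sphereNormSq_nonneg (ζ : ℝ³ → ℝ³) (x₀ : ℝ³) (r : ℝ) : 0 ≤ sphereNormSq ζ x₀ r :=
  integral_nonneg fun _ => sq_nonneg _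

/-- Translating a set integral to the centre `x₀` (Lebesgue measure is translation invariant). [folklore] -/
theorem setIntegral_comp_sub_centre (F : ℝ³ → ℝ) (P : ℝ³ → Prop) (x₀ : ℝ³) :
    ∫ x in {x : ℝ³ | P (x - x₀)}, F x = ∫ y in {y : ℝ³ | P y}, F (x₀ + y) := by
  have h := (measurePreserving_add_left (volume : Measure ℝ³) x₀).setIntegral_preimage_emb
    (Homeomorph.addLeft x₀).measurableEmbedding F {x : ℝ³ | P (x - x₀)}
  rw [← h]
  congr 1
  ext y
  simp

/-- **A layer integral of the radial derivative in polar coordinates** (`ℝ³`, centre `x₀`): for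
`ζ ∈ C¹` and `0 < α ≤ β`,
`∫_{α<‖x−x₀‖<β} ∂ᵣ|ζ|² = β² S(β) − α² S(α) − 2∫_{α<‖x−x₀‖<β} |ζ|²/‖x − x₀‖`
(`SphereIntegral.setIntegral_shell_radialDeriv_eq` with `dim = 3`, translated to `x₀`). [folklore] -/
theorem setIntegral_layer_radialDerivNormSq (hζ : ContDiff ℝ 1 ζ) (x₀ : ℝ³) {α β : ℝ}
    (hα : 0 < α) (hαβ : α ≤ β) :
    ∫ x in {x : ℝ³ | α < ‖x - x₀‖ ∧ ‖x - x₀‖ < β}, radialDerivNormSq ζ x₀ x =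
      β ^ 2 * sphereNormSq ζ x₀ β - α ^ 2 * sphereNormSq ζ x₀ α -
        2 * ∫ x in {x : ℝ³ | α < ‖x - x₀‖ ∧ ‖x - x₀‖ < β}, ‖x - x₀‖⁻¹ * ‖ζ x‖ ^ 2 := by
  have hN : ContDiff ℝ 1 fun y : ℝ³ => ‖ζ (x₀ + y)‖ ^ 2 :=
    (hζ.comp (contDiff_const.add contDiff_id)).norm_sq ℝ
  -- translate both layer integrals to the origin
  rw [setIntegral_comp_sub_centre (radialDerivNormSq ζ x₀) (fun y => α < ‖y‖ ∧ ‖y‖ < β) x₀,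
    setIntegral_comp_sub_centre (fun x => ‖x - x₀‖⁻¹ * ‖ζ x‖ ^ 2) (fun y => α < ‖y‖ ∧ ‖y‖ < β) x₀]
  -- the translated radial derivative is the radial derivative of the translated function
  have hrad : ∀ y : ℝ³, radialDerivNormSq ζ x₀ (x₀ + y) =
      fderiv ℝ (fun y : ℝ³ => ‖ζ (x₀ + y)‖ ^ 2) y (‖y‖⁻¹ • y) := fun y => by
    have hNd : DifferentiableAt ℝ (fun z : ℝ³ => ‖ζ z‖ ^ 2) (x₀ + y) :=
      ((hζ.norm_sq ℝ).differentiable one_ne_zero) _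
    have hc : HasFDerivAt (fun y : ℝ³ => ‖ζ (x₀ + y)‖ ^ 2)
        ((fderiv ℝ (fun z : ℝ³ => ‖ζ z‖ ^ 2) (x₀ + y)).comp (ContinuousLinearMap.id ℝ ℝ³)) y :=
      hNd.hasFDerivAt.comp y ((hasFDerivAt_id y).const_add x₀)
    rw [radialDerivNormSq_apply, add_sub_cancel_left, hc.fderiv, ContinuousLinearMap.comp_id]
  simp_rw [hrad, add_sub_cancel_left]
  have h := setIntegral_shell_radialDeriv_eq (volume : Measure ℝ³) hN hα hαβ
  rw [finrank_euclideanSpace_fin] at h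
  simp only [show (3 : ℕ) - 1 = 2 by norm_num, Nat.cast_ofNat, smul_eq_mul] at h
  rw [h, sphereNormSq_def, sphereNormSq_def]

end Polar

/-! ## The bound `Y₃ ≤ b` -/

section Bound

variable {ζ : ℝ³ → ℝ³} {x₀ : ℝ³} {k a b ν : ℝ}

/-- **Tao's heat-flux bound `Y₃ ≲ b(t)` for the annular cutoff.** For `ζ ∈ C¹`, `ν ≥ 0`,
`η = annularRamp k a b ‖· − x₀‖` with `0 < a`, `k > 0` and a nonempty plateau, the heat-flux term
`Y₃` (`= ½∫|ζ|²Δη` in Tao's distributional form, p. 31; here in the integrated-by-parts form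
`−ν Σⱼ ∫ ⟨ζ, ∂ⱼζ⟩ ∂ⱼη` in which it appears in `TaoEnstrophyIdentity.integral_enstrophyProduction_mul_weight`,
the two agreeing for Lipschitz `η`) satisfies
`Y₃ ≤ (νk/2)(a² S(a) + b² S(b)) + νk ∫_{inner layer} |ζ|²/‖x − x₀‖`,
where `S(r) = ∫|ζ(x₀ + rα)|²dσ(α)`: the sphere terms come from the two jumps of `∂ᵣη` that carry a
positive sign ("while `Δη` also has a component on the sphere `|x| = R'(t) − c^{0.1}δ^{-2}`, this
component is negative and thus can be discarded"), the layer term from the curvature `2/ρ` of the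
inner ramp (absent in Tao's ball case). [cite: Tao2011, §10, proof of Thm. 10.1 (Y₃ ≲ b(t))] -/
theorem heatFlux_le (hζ : ContDiff ℝ 1 ζ) (hν : 0 ≤ ν) (hk : 0 < k) (ha : 0 < a)
    (hgap : a + k⁻¹ < b - k⁻¹) :
    -(ν * ∑ j, ∫ x, ⟪ζ x, fderiv ℝ ζ x (𝐞 j)⟫ *
        lineDeriv ℝ (fun y : ℝ³ => annularRamp k a b ‖y - x₀‖) x (𝐞 j)) ≤
      ν * k / 2 * (a ^ 2 * sphereNormSq ζ x₀ a + b ^ 2 * sphereNormSq ζ x₀ b) +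
        ν * k * ∫ x in {x : ℝ³ | a < ‖x - x₀‖ ∧ ‖x - x₀‖ < a + k⁻¹}, ‖x - x₀‖⁻¹ * ‖ζ x‖ ^ 2 := by
  have hkinv : 0 < k⁻¹ := inv_pos.2 hk
  have hb : 0 < b - k⁻¹ := by linarith
  rw [sum_integral_inner_fderiv_mul_lineDeriv_annularRamp hζ hk ha hgap,
    setIntegral_layer_radialDerivNormSq hζ x₀ ha (by linarith),
    setIntegral_layer_radialDerivNormSq hζ x₀ hb (by linarith)]
  -- signs: `S ≥ 0` and the layer integrals of `|ζ|²/ρ` are `≥ 0`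
  have hS1 := sphereNormSq_nonneg ζ x₀ (a + k⁻¹)
  have hS2 := sphereNormSq_nonneg ζ x₀ (b - k⁻¹)
  have hS3 := sphereNormSq_nonneg ζ x₀ a
  have hS4 := sphereNormSq_nonneg ζ x₀ b
  have hρ : Continuous fun x : ℝ³ => ‖x - x₀‖ := by fun_prop
  have hJ : ∀ α β : ℝ, 0 ≤ ∫ x in {x : ℝ³ | α < ‖x - x₀‖ ∧ ‖x - x₀‖ < β}, ‖x - x₀‖⁻¹ * ‖ζ x‖ ^ 2 :=
    fun α β => setIntegral_nonneg ((isOpen_lt continuous_const hρ).measurableSet.inter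
      (isOpen_lt hρ continuous_const).measurableSet)
      fun x _ => mul_nonneg (inv_nonneg.2 (norm_nonneg _)) (sq_nonneg _)
  have hJ1 := hJ a (a + k⁻¹)
  have hJ2 := hJ (b - k⁻¹) b
  have hνk : 0 ≤ ν * k := mul_nonneg hν hk.le
  nlinarith [mul_nonneg hνk (mul_nonneg (sq_nonneg (a + k⁻¹)) hS1),
    mul_nonneg hνk (mul_nonneg (sq_nonneg (b - k⁻¹)) hS2), mul_nonneg hνk hJ2,
    mul_nonneg hνk (mul_nonneg (sq_nonneg a) hS3), mul_nonneg hνk (mul_nonneg (sq_nonneg b) hS4),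
    mul_nonneg hνk hJ1]

end Bound

end Literature.Analysis.FluidPDE

end
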